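import Summits.QuantumFields.YangMills.Theses.LangevinControlUV
import Summits.QuantumFields.YangMills.Theorems.LangevinControlUVLatticeGapInUVUnitsKnabeAmplification
import Summits.QuantumFields.YangMills.Theorems.LangevinControlUVLatticeGapInUVUnitsLightCone
import Summits.QuantumFields.YangMills.Theorems.LangevinControlUVLatticeGapInUVUnitsSamplerTranscription
import Summits.QuantumFields.YangMills.Theorems.LangevinControlUVLatticeGapInUVUnitsGapToClustering
import Summits.QuantumFields.YangMills.Theorems.LangevinControlUVLatticeGapInUVUnitsSpectralToolkit
import Literature.Analysis.OperatorTheory.KnabeGapAmplification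
import Literature.MathematicalPhysics.QuantumLattice.WilsonBlockHeatBath

/-!
# Crux `LatticeGapInUVUnits`, line `knabe-block-sampler`: the checked reduction to the block-sampler certificate

Support file for item stmt-QuantumFields-9366 (route `LangevinControlUV` of `YangMills`).  With the five provable
stubs of the line LANDED — S1 `stub_knabeAmplification` (p81103), S3 `stub_samplerTranscription` (p86700), S4
`stub_gapToClustering` (p90222), S5 `stub_spectralToolkit` (p90500), S6 `stub_lightCone` (p80165) — the line's
composition becomes two kernel-checked implications, stated here with every hypothesis WRITTEN OUT in the route's
own vocabulary (no definition is introduced):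

* `cruxRepaired_of_blockSamplerCertificate` : the block-sampler certificate S2 ALONE (one β- and n₀-uniform local
  Poincaré inequality `LocalPoincare r.ρ β N ⌈K/a β⌉₊ n₀ γ` of the overlapping block heat bath, for continuous unit maps
  carrying the femto package) implies the REPAIRED crux C′ of the standing disprover (`Disproof.lean` §9
  `CruxRepaired`: the crux restricted to continuous unit maps);
* `latticeGapInUVUnits_of_rulerReduction_of_blockSamplerCertificate` : together with the typed-`∀a` socket S0
  (`RulerReduction`: every unit map with the package is eventually dominated by a continuous one with the package —
  where the known misstatement of the crux is parked) it implies the crux `LatticeGapInUVUnits` BY NAME.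

The proofs are the line's pipeline: patch size `n₀` from `t n₀ < γ/2` (S1's threshold `t → 0`), nominal cell
`b = ⌈K/a β⌉` with `b · a(β) ≤ 2K` from `a → 0` (the load-bearing clause of the package, Disproof §4), S3 turns the
local inequality into the global one with constant `c(γ − t n₀) > 0` (spectral step S5.1), S4 turns that into
clustering at rate `ρ n/b ≥ (ρ/2K)·a(β)·n` (S5.2 + S6), and domination `a ≤ K₀ a'` costs the factor `K₀` in the rate.
-/

open scoped BigOperators InnerProductSpace
open MeasureTheory Filter Topology
open Literature.MathematicalPhysics.QuantumFieldTheory Literature.MathematicalPhysics.QuantumLattice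
open Literature.MathematicalPhysics.QuantumLattice.WilsonBlockHeatBath
open Literature.Analysis.OperatorTheory.KnabeDevice
open Summit.QuantumFields.YangMills.Theses.LangevinControlUV

noncomputable section

namespace Summit.QuantumFields.YangMills.Theorems.LatticeGapInUVUnits.KnabeBlockSampler

section Pipeline

variable {G : Type} [Group G] [TopologicalSpace G] [IsTopologicalGroup G] [CompactSpace G]
  [MeasurableSpace G] [BorelSpace G]

/-- **Domination transfer** (Disproof §1/§2 in one step): clustering in the units of `a'` and `a ≤ K₀ a'`
eventually give clustering in the units of `a`, with rate constant `c₁/K₀`. -/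
theorem reduction_concl_of_dominated (r : LatticeRep G) {a a' : ℝ → ℝ}
    (h : ∃ (c₁ β₂ : ℝ) (S₁ : ℝ → ℕ), 0 < c₁ ∧ ∀ A B : YMSpecies G, ∃ C : ℝ, ∀ β : ℝ, β₂ ≤ β → ∀ S n : ℕ, S₁ β ≤ S → n ≤ S → |latticeConnectedCorr r.ρ β (2 * S + 1) A.F B.F n| ≤ C * Real.exp (-(c₁ * a' β * n)))
    {K₀ : ℝ} (hK : 0 < K₀) (hdom : ∀ᶠ β in atTop, a β ≤ K₀ * a' β) :
    ∃ (c₁ β₂ : ℝ) (S₁ : ℝ → ℕ), 0 < c₁ ∧ ∀ A B : YMSpecies G, ∃ C : ℝ, ∀ β : ℝ, β₂ ≤ β → ∀ S n : ℕ, S₁ β ≤ S → n ≤ S → |latticeConnectedCorr r.ρ β (2 * S + 1) A.F B.F n| ≤ C * Real.exp (-(c₁ * a β * n)) := by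
  obtain ⟨c₁, β₂, S₁, hc, h⟩ := h
  obtain ⟨βs, hβs⟩ := eventually_atTop.1 hdom
  refine ⟨c₁ / K₀, max β₂ βs, S₁, div_pos hc hK, fun A B => ?_⟩
  obtain ⟨C, hC⟩ := h A B
  refine ⟨max C 0, fun β hβ S n hS hn => ?_⟩
  have hβ₂ : β₂ ≤ β := (le_max_left _ _).trans hβ
  have hle : a β ≤ K₀ * a' β := hβs β ((le_max_right _ _).trans hβ)
  refine (hC β hβ₂ S n hS hn).trans ?_
  have hn0 : (0 : ℝ) ≤ n := Nat.cast_nonneg n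
  have key : c₁ / K₀ * a β * n ≤ c₁ * a' β * n := by
    refine mul_le_mul_of_nonneg_right ?_ hn0
    calc c₁ / K₀ * a β ≤ c₁ / K₀ * (K₀ * a' β) := mul_le_mul_of_nonneg_left hle (div_pos hc hK).le
      _ = c₁ / K₀ * K₀ * a' β := by ring
      _ = c₁ * a' β := by rw [div_mul_cancel₀ c₁ hK.ne']
  calc C * Real.exp (-(c₁ * a' β * n)) ≤ max C 0 * Real.exp (-(c₁ * a' β * n)) :=
        mul_le_mul_of_nonneg_right (le_max_left _ _) (Real.exp_pos _).le
    _ ≤ max C 0 * Real.exp (-(c₁ / K₀ * a β * n)) :=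
        mul_le_mul_of_nonneg_left (Real.exp_le_exp.2 (neg_le_neg key)) (le_max_right _ _)

/-- **The pipeline S1 + (local certificate) + S3 + S4 (+ S5, S6) ⇒ clustering in the units of `a`.** From S1's
`(t, c)` choose the patch size `n₀` with `t n₀ < γ/2`; from `a → 0` choose `β₃` with `a β ≤ K` beyond it, so that the
nominal cell `b = ⌈K/a β⌉` satisfies `b · a(β) ≤ 2K`; S3 transcribes the local inequality on the torus `(2S+1)⁴`,
`S ≥ S₁ β := (4n₀+8)⌈K/a β⌉`, into the global one with constant `c(γ − t n₀) > 0`, and S4 turns it into clustering at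
rate `ρ n/b ≥ (ρ/2K) a(β) n`. -/
theorem reduction_concl_of_localPoincare (r : LatticeRep G) {a : ℝ → ℝ} (hpos : ∀ β, 0 < a β)
    (hlim : Tendsto a atTop (𝓝 0)) {K γ : ℝ} (hKpos : 0 < K) (hγ : 0 < γ)
    (hloc : ∀ n₀ : ℕ, 1 ≤ n₀ → ∃ β₂ : ℝ, ∀ β : ℝ, β₂ ≤ β → ∀ (N : ℕ) [NeZero N],
      (4 * n₀ + 8) * ⌈K / a β⌉₊ ≤ N → LocalPoincare r.ρ β N ⌈K / a β⌉₊ n₀ γ) :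
    ∃ (c₁ β₂ : ℝ) (S₁ : ℝ → ℕ), 0 < c₁ ∧ ∀ A B : YMSpecies G, ∃ C : ℝ, ∀ β : ℝ, β₂ ≤ β → ∀ S n : ℕ, S₁ β ≤ S → n ≤ S → |latticeConnectedCorr r.ρ β (2 * S + 1) A.F B.F n| ≤ C * Real.exp (-(c₁ * a β * n)) := by
  obtain ⟨t, c, hc, ht, hKW⟩ := stub_knabeAmplification
  -- patch size from the threshold `t → 0`
  have hev : ∀ᶠ n in atTop, t n < γ / 2 := ht (Iio_mem_nhds (half_pos hγ))
  obtain ⟨n₀, hn₀, htn₀⟩ := ((eventually_ge_atTop 1).and hev).exists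
  have htn₀' : t n₀ < γ := by linarith
  obtain ⟨β₂, hβ₂⟩ := hloc n₀ hn₀
  have hgl : 0 < c * (γ - t n₀) := mul_pos hc (by linarith)
  obtain ⟨ρ, hρ, hAB⟩ := stub_gapToClustering stub_spectralToolkit.2 stub_lightCone G r (c * (γ - t n₀)) hgl
  -- `a β ≤ K` eventually (this is where `Tendsto a atTop (𝓝 0)` is load-bearing, Disproof §4)
  have hevK : ∀ᶠ β in atTop, a β < K := hlim (Iio_mem_nhds hKpos)
  obtain ⟨β₃, hβ₃⟩ := eventually_atTop.1 hevK
  refine ⟨ρ / (2 * K), max β₂ β₃, fun β => (4 * n₀ + 8) * ⌈K / a β⌉₊, by positivity, fun A B => ?_⟩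
  obtain ⟨C, hCAB⟩ := hAB A B
  refine ⟨max C 0, fun β hβ S n hS hn => ?_⟩
  have hβ2 : β₂ ≤ β := (le_max_left _ _).trans hβ
  have haK : a β < K := hβ₃ β ((le_max_right _ _).trans hβ)
  have hKa : 0 < K / a β := div_pos hKpos (hpos β)
  have hb1 : 1 ≤ ⌈K / a β⌉₊ := Nat.one_le_iff_ne_zero.2 (Nat.ceil_pos.2 hKa).ne'
  have hN : (4 * n₀ + 8) * ⌈K / a β⌉₊ ≤ 2 * S + 1 := hS.trans (by omega)
  have hLP : LocalPoincare r.ρ β (2 * S + 1) ⌈K / a β⌉₊ n₀ γ := hβ₂ β hβ2 (2 * S + 1) hN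
  have hGP : GlobalPoincare r.ρ β (2 * S + 1) ⌈K / a β⌉₊ (c * (γ - t n₀)) :=
    stub_samplerTranscription stub_spectralToolkit.1 t c hKW hc G r β (2 * S + 1) ⌈K / a β⌉₊ n₀ γ hn₀ hb1 hN hγ
      htn₀' hLP
  have hcorr := hCAB β ⌈K / a β⌉₊ S n hb1 hn hGP
  refine hcorr.trans ?_
  -- compare the exponents: `ρ/(2K) · a β · n ≤ ρ · n / ⌈K/a β⌉` because `⌈K/a β⌉ · a β ≤ 2K`
  have hbR : ((⌈K / a β⌉₊ : ℕ) : ℝ) < K / a β + 1 := Nat.ceil_lt_add_one hKa.le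
  have hba : ((⌈K / a β⌉₊ : ℕ) : ℝ) * a β ≤ 2 * K := by
    have h1 : ((⌈K / a β⌉₊ : ℕ) : ℝ) * a β < (K / a β + 1) * a β := mul_lt_mul_of_pos_right hbR (hpos β)
    have h2 : (K / a β + 1) * a β = K + a β := by
      rw [add_mul, one_mul, div_mul_cancel₀ K (hpos β).ne']
    linarith
  have hbpos : (0 : ℝ) < ((⌈K / a β⌉₊ : ℕ) : ℝ) := by exact_mod_cast hb1
  have key : ρ / (2 * K) * a β * n ≤ ρ * n / (⌈K / a β⌉₊ : ℕ) := by
    rw [le_div_iff₀ hbpos]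
    have e : ρ / (2 * K) * a β * n * ((⌈K / a β⌉₊ : ℕ) : ℝ) =
        ρ * n * ((((⌈K / a β⌉₊ : ℕ) : ℝ)) * a β) / (2 * K) := by ring
    rw [e, div_le_iff₀ (by positivity : (0 : ℝ) < 2 * K)]
    exact mul_le_mul_of_nonneg_left hba (by positivity)
  calc C * Real.exp (-(ρ * n / (⌈K / a β⌉₊ : ℕ))) ≤ max C 0 * Real.exp (-(ρ * n / (⌈K / a β⌉₊ : ℕ))) :=
        mul_le_mul_of_nonneg_right (le_max_left _ _) (Real.exp_pos _).le
    _ ≤ max C 0 * Real.exp (-(ρ / (2 * K) * a β * n)) :=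
        mul_le_mul_of_nonneg_left (Real.exp_le_exp.2 (neg_le_neg key)) (le_max_right _ _)

end Pipeline

/-- **The repaired crux C′ from the block-sampler certificate alone** (line `knabe-block-sampler`, S2 ⇒ C′): for
every compact simple `G`, faithful `r` and CONTINUOUS unit map `a` carrying the femto two-point package, a `β`- and
`n₀`-uniform local Poincaré inequality of the overlapping block heat bath at cell `⌈K/a β⌉` yields volume-uniform
exponential clustering of all pairs of gauge-invariant local observables at rate `c₁ · a(β)` per lattice step —
verbatim the standing disprover's `CruxRepaired` (the crux restricted to continuous unit maps), with both sides
written out. -/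
theorem cruxRepaired_of_blockSamplerCertificate :
    (∀ (G : Type) [Group G] [TopologicalSpace G] [IsTopologicalGroup G] [CompactSpace G], IsCompactSimpleLieGroup G → letI : MeasurableSpace G := borel G; haveI : BorelSpace G := ⟨rfl⟩; ∀ (r : LatticeRep G) (a : ℝ → ℝ), Continuous a → (∃ (Γ : ℝ → ℝ) (β₀ ℓ₀ c C : ℝ), 0 < ℓ₀ ∧ 0 < c ∧ (∀ β, 0 < a β) ∧ Filter.Tendsto a Filter.atTop (nhds 0) ∧ (∀ s : ℝ, 0 < s → s ≤ ℓ₀ → 0 < Γ s ∧ Γ s ≤ 1) ∧ ∀ (L : ℕ) [NeZero L] (β : ℝ), β₀ ≤ β → (L : ℝ) * a β ≤ ℓ₀ → let P : (Fin 4 → ZMod L) → Fin 4 → Fin 4 → GaugeConfig 4 L G → ℝ := fun x i j U => (r.N : ℝ) - (r.ρ (plaquetteHolonomy U x i j)).trace.re; let E : (GaugeConfig 4 L G → ℝ) → ℝ := fun F => wilsonExpectation (d := 4) (L := L) r.ρ β F; let cov : (GaugeConfig 4 L G → ℝ) → (GaugeConfig 4 L G → ℝ) → ℝ := fun F F' =>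 E (fun U => F U * F' U) - E F * E F'; let dist : (Fin 4 → ZMod L) → (Fin 4 → ZMod L) → ℝ := fun x y => Real.sqrt (∑ k : Fin 4, (((x k - y k).valMinAbs : ℤ) : ℝ) ^ 2); (∀ n : ℕ, 1 ≤ n → 8 * n ≤ L → c * Γ ((n : ℝ) * a β) ≤ (n : ℝ) ^ 8 * cov (P 0 0 1) (P (Pi.single (2 : Fin 4) ((n : ℕ) : ZMod L)) 0 1) ∧ (n : ℝ) ^ 8 * cov (P 0 0 1) (P (Pi.single (2 : Fin 4) ((n : ℕ) : ZMod L)) 0 1) ≤ C * Γ ((n : ℝ) * a β)) ∧ (∀ (x y : Fin 4 → ZMod L) (i j i' j' : Fin 4), x ≠ y → i ≠ j → i' ≠ j' → |cov (P x i j) (P y i' j')| * dist x y ^ 8 ≤ C * Γ (dist x y * a β))) → ∃ (K γ : ℝ), 0 < K ∧ 0 < γ ∧ ∀ n₀ : ℕ, 1 ≤ n₀ → ∃ β₂ : ℝ, ∀ β : ℝ, β₂ ≤ β → ∀ (N : ℕ) [NeZero N], (4 * n₀ + 8) * ⌈K / a β⌉₊ ≤ N → LocalPoincare r.ρ β N ⌈K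 / a β⌉₊ n₀ γ) →
    ∀ (G : Type) [Group G] [TopologicalSpace G] [IsTopologicalGroup G] [CompactSpace G], IsCompactSimpleLieGroup G → letI : MeasurableSpace G := borel G; haveI : BorelSpace G := ⟨rfl⟩; ∀ (r : LatticeRep G) (a : ℝ → ℝ), Continuous a → (∃ (Γ : ℝ → ℝ) (β₀ ℓ₀ c C : ℝ), 0 < ℓ₀ ∧ 0 < c ∧ (∀ β, 0 < a β) ∧ Filter.Tendsto a Filter.atTop (nhds 0) ∧ (∀ s : ℝ, 0 < s → s ≤ ℓ₀ → 0 < Γ s ∧ Γ s ≤ 1) ∧ ∀ (L : ℕ) [NeZero L] (β : ℝ), β₀ ≤ β → (L : ℝ) * a β ≤ ℓ₀ → let P : (Fin 4 → ZMod L) → Fin 4 → Fin 4 → GaugeConfig 4 L G → ℝ := fun x i j U => (r.N : ℝ) - (r.ρ (plaquetteHolonomy U x i j)).trace.re; let E : (GaugeConfig 4 L G → ℝ) → ℝ := fun F => wilsonExpectation (d := 4) (L := L) r.ρ β F; let cov : (GaugeConfig 4 L G → ℝ) → (GaugeConfig 4 L G → ℝ) → ℝ := fun F F' => E (fun U =>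 F U * F' U) - E F * E F'; let dist : (Fin 4 → ZMod L) → (Fin 4 → ZMod L) → ℝ := fun x y => Real.sqrt (∑ k : Fin 4, (((x k - y k).valMinAbs : ℤ) : ℝ) ^ 2); (∀ n : ℕ, 1 ≤ n → 8 * n ≤ L → c * Γ ((n : ℝ) * a β) ≤ (n : ℝ) ^ 8 * cov (P 0 0 1) (P (Pi.single (2 : Fin 4) ((n : ℕ) : ZMod L)) 0 1) ∧ (n : ℝ) ^ 8 * cov (P 0 0 1) (P (Pi.single (2 : Fin 4) ((n : ℕ) : ZMod L)) 0 1) ≤ C * Γ ((n : ℝ) * a β)) ∧ (∀ (x y : Fin 4 → ZMod L) (i j i' j' : Fin 4), x ≠ y → i ≠ j → i' ≠ j' → |cov (P x i j) (P y i' j')| * dist x y ^ 8 ≤ C * Γ (dist x y * a β))) → ∃ (c₁ β₂ : ℝ) (S₁ : ℝ → ℕ), 0 < c₁ ∧ ∀ A B : YMSpecies G, ∃ C : ℝ, ∀ β : ℝ, β₂ ≤ β → ∀ S n : ℕ, S₁ β ≤ S → n ≤ S → |latticeConnectedCorr r.ρ β (2 * S + 1) A.F B.F n| ≤ C * Real.exp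 (-(c₁ * a β * n)) := by
  intro h2 G _ _ _ _ hG
  letI : MeasurableSpace G := borel G
  haveI : BorelSpace G := ⟨rfl⟩
  intro r a ha hP
  obtain ⟨K, γ, hK, hγ, hloc⟩ := h2 G hG r a ha hP
  obtain ⟨Γ, β₀, ℓ₀, c, C, -, -, hpos, hlim, -, -⟩ := hP
  exact reduction_concl_of_localPoincare r hpos hlim hK hγ hloc

/-- **The crux BY NAME from the two remaining stubs of the line** (S0 ruler reduction + S2 block-sampler
certificate): S0 hands, for every unit map with the package, a continuous dominating unit map `a'` with the package;
S2 certifies the sampler at `a'`; the landed pipeline clusters in the units of `a'`; domination returns to the units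
of `a`. -/
theorem latticeGapInUVUnits_of_rulerReduction_of_blockSamplerCertificate :
    (∀ (G : Type) [Group G] [TopologicalSpace G] [IsTopologicalGroup G] [CompactSpace G], IsCompactSimpleLieGroup G → letI : MeasurableSpace G := borel G; haveI : BorelSpace G := ⟨rfl⟩; ∀ (r : LatticeRep G) (a : ℝ → ℝ), (∃ (Γ : ℝ → ℝ) (β₀ ℓ₀ c C : ℝ), 0 < ℓ₀ ∧ 0 < c ∧ (∀ β, 0 < a β) ∧ Filter.Tendsto a Filter.atTop (nhds 0) ∧ (∀ s : ℝ, 0 < s → s ≤ ℓ₀ → 0 < Γ s ∧ Γ s ≤ 1) ∧ ∀ (L : ℕ) [NeZero L] (β : ℝ), β₀ ≤ β → (L : ℝ) * a β ≤ ℓ₀ → let P : (Fin 4 → ZMod L) → Fin 4 → Fin 4 → GaugeConfig 4 L G → ℝ := fun x i j U => (r.N : ℝ) - (r.ρ (plaquetteHolonomy U x i j)).trace.re; let E : (GaugeConfig 4 L G → ℝ) → ℝ := fun F => wilsonExpectation (d := 4) (L := L) r.ρ β F; let cov : (GaugeConfig 4 L G → ℝ) → (GaugeConfig 4 L G → ℝ)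 → ℝ := fun F F' => E (fun U => F U * F' U) - E F * E F'; let dist : (Fin 4 → ZMod L) → (Fin 4 → ZMod L) → ℝ := fun x y => Real.sqrt (∑ k : Fin 4, (((x k - y k).valMinAbs : ℤ) : ℝ) ^ 2); (∀ n : ℕ, 1 ≤ n → 8 * n ≤ L → c * Γ ((n : ℝ) * a β) ≤ (n : ℝ) ^ 8 * cov (P 0 0 1) (P (Pi.single (2 : Fin 4) ((n : ℕ) : ZMod L)) 0 1) ∧ (n : ℝ) ^ 8 * cov (P 0 0 1) (P (Pi.single (2 : Fin 4) ((n : ℕ) : ZMod L)) 0 1) ≤ C * Γ ((n : ℝ) * a β)) ∧ (∀ (x y : Fin 4 → ZMod L) (i j i' j' : Fin 4), x ≠ y → i ≠ j → i' ≠ j' → |cov (P x i j) (P y i' j')| * dist x y ^ 8 ≤ C * Γ (dist x y * a β))) → ∃ (a' : ℝ → ℝ) (K₀ : ℝ), Continuous a' ∧ (∃ (Γ : ℝ → ℝ) (β₀ ℓ₀ c C : ℝ), 0 < ℓ₀ ∧ 0 < c ∧ (∀ β, 0 < a' β) ∧ Filter.Tendsto a' Filter.atTop (nhds 0) ∧ (∀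 s : ℝ, 0 < s → s ≤ ℓ₀ → 0 < Γ s ∧ Γ s ≤ 1) ∧ ∀ (L : ℕ) [NeZero L] (β : ℝ), β₀ ≤ β → (L : ℝ) * a' β ≤ ℓ₀ → let P : (Fin 4 → ZMod L) → Fin 4 → Fin 4 → GaugeConfig 4 L G → ℝ := fun x i j U => (r.N : ℝ) - (r.ρ (plaquetteHolonomy U x i j)).trace.re; let E : (GaugeConfig 4 L G → ℝ) → ℝ := fun F => wilsonExpectation (d := 4) (L := L) r.ρ β F; let cov : (GaugeConfig 4 L G → ℝ) → (GaugeConfig 4 L G → ℝ) → ℝ := fun F F' => E (fun U => F U * F' U) - E F * E F'; let dist : (Fin 4 → ZMod L) → (Fin 4 → ZMod L) → ℝ := fun x y => Real.sqrt (∑ k : Fin 4, (((x k - y k).valMinAbs : ℤ) : ℝ) ^ 2); (∀ n : ℕ, 1 ≤ n → 8 * n ≤ L → c * Γ ((n : ℝ) * a' β) ≤ (n : ℝ) ^ 8 * cov (P 0 0 1) (P (Pi.single (2 : Fin 4) ((n : ℕ) : ZMod L)) 0 1) ∧ (n : ℝ) ^ 8 * cov (P 0 0 1) (P (Pi.single (2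 : Fin 4) ((n : ℕ) : ZMod L)) 0 1) ≤ C * Γ ((n : ℝ) * a' β)) ∧ (∀ (x y : Fin 4 → ZMod L) (i j i' j' : Fin 4), x ≠ y → i ≠ j → i' ≠ j' → |cov (P x i j) (P y i' j')| * dist x y ^ 8 ≤ C * Γ (dist x y * a' β))) ∧ 0 < K₀ ∧ ∀ᶠ β in Filter.atTop, a β ≤ K₀ * a' β) →
    (∀ (G : Type) [Group G] [TopologicalSpace G] [IsTopologicalGroup G] [CompactSpace G], IsCompactSimpleLieGroup G → letI : MeasurableSpace G := borel G; haveI : BorelSpace G := ⟨rfl⟩; ∀ (r : LatticeRep G) (a : ℝ → ℝ), Continuous a → (∃ (Γ : ℝ → ℝ) (β₀ ℓ₀ c C : ℝ), 0 < ℓ₀ ∧ 0 < c ∧ (∀ β, 0 < a β) ∧ Filter.Tendsto a Filter.atTop (nhds 0) ∧ (∀ s : ℝ, 0 < s → s ≤ ℓ₀ → 0 < Γ s ∧ Γ s ≤ 1) ∧ ∀ (L : ℕ) [NeZero L] (β : ℝ), β₀ ≤ β → (L : ℝ) * a β ≤ ℓ₀ → let P : (Fin 4 → ZMod L) → Fin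 4 → Fin 4 → GaugeConfig 4 L G → ℝ := fun x i j U => (r.N : ℝ) - (r.ρ (plaquetteHolonomy U x i j)).trace.re; let E : (GaugeConfig 4 L G → ℝ) → ℝ := fun F => wilsonExpectation (d := 4) (L := L) r.ρ β F; let cov : (GaugeConfig 4 L G → ℝ) → (GaugeConfig 4 L G → ℝ) → ℝ := fun F F' => E (fun U => F U * F' U) - E F * E F'; let dist : (Fin 4 → ZMod L) → (Fin 4 → ZMod L) → ℝ := fun x y => Real.sqrt (∑ k : Fin 4, (((x k - y k).valMinAbs : ℤ) : ℝ) ^ 2); (∀ n : ℕ, 1 ≤ n → 8 * n ≤ L → c * Γ ((n : ℝ) * a β) ≤ (n : ℝ) ^ 8 * cov (P 0 0 1) (P (Pi.single (2 : Fin 4) ((n : ℕ) : ZMod L)) 0 1) ∧ (n : ℝ) ^ 8 * cov (P 0 0 1) (P (Pi.single (2 : Fin 4) ((n : ℕ) : ZMod L)) 0 1) ≤ C * Γ ((n : ℝ) * a β)) ∧ (∀ (x y : Fin 4 → ZMod L) (i j i' j' : Fin 4), x ≠ y → i ≠ j → i' ≠ j' → |cov (P x i j) (P y i' j')| * dist x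 y ^ 8 ≤ C * Γ (dist x y * a β))) → ∃ (K γ : ℝ), 0 < K ∧ 0 < γ ∧ ∀ n₀ : ℕ, 1 ≤ n₀ → ∃ β₂ : ℝ, ∀ β : ℝ, β₂ ≤ β → ∀ (N : ℕ) [NeZero N], (4 * n₀ + 8) * ⌈K / a β⌉₊ ≤ N → LocalPoincare r.ρ β N ⌈K / a β⌉₊ n₀ γ) →
    LatticeGapInUVUnits := by
  intro h0 h2 G _ _ _ _ hG
  letI : MeasurableSpace G := borel G
  haveI : BorelSpace G := ⟨rfl⟩
  intro r a hP
  obtain ⟨a', K₀, ha', hP', hK₀, hdom⟩ := h0 G hG r a hP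
  obtain ⟨K, γ, hK, hγ, hloc⟩ := h2 G hG r a' ha' hP'
  obtain ⟨Γ, β₀, ℓ₀, c, C, -, -, hpos, hlim, -, -⟩ := hP'
  exact reduction_concl_of_dominated r (reduction_concl_of_localPoincare r hpos hlim hK hγ hloc) hK₀ hdom

end Summit.QuantumFields.YangMills.Theorems.LatticeGapInUVUnits.KnabeBlockSampler

end
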